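import Mathlib.Algebra.Star.Module
import Mathlib.Analysis.Calculus.ContDiff.Operations
import Mathlib.Analysis.Calculus.Deriv.Shift
import Mathlib.Topology.UniformSpace.UniformConvergenceTopology
import Mathlib.MeasureTheory.Constructions.BorelSpace.Basic
import Literature.MathematicalPhysics.QuantumLattice.YangMillsClassical
import HarnessLib

/-!
# The Yang–Mills heat flow on flat space and the space of flow lines modulo gauge

Over the vocabulary of `YangMillsClassical` (`Connection E 𝔸 = E → E →L[ℝ] 𝔸`, trivial bundle
over a finite-dimensional real inner product space `E`, coefficients in a real normed algebra `𝔸`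
with the commutator bracket; `curvature`, `covDeriv`, `gaugeAct`):

* `gaugeAct_one/mul/inv_gaugeAct`: `gaugeAct` is a left action of differentiable `g : E → 𝔸ˣ`;
  `smoothGaugeGroup E U`: smooth `g` valued in a subgroup `U ≤ 𝔸ˣ` (e.g. `unitaryUnits 𝔸`,
  which is `U(N)` for `𝔸 = M_N(ℂ)`).
* `divCurvature A x v = ∑ᵢ D_{eᵢ} F_A(eᵢ, v)(x) = −(D_A^* F_A)(x)(v)`;
  `IsYangMillsConnection A ↔ divCurvature A = 0` (`Iff.rfl`).
* `IsYangMillsHeatFlow 𝔤 A` (`A : ℝ → Connection E 𝔸`): for every `t > 0`, `A t` is smooth in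
  `x` and `𝔤`-valued, `t ↦ A t x v` is `C¹` on `(0,∞)`, and the **Yang–Mills heat (gradient)
  flow** `∂ₜ A = −D_A^* F_A`, i.e. `∂ₜ A_ν = ∑_μ D_μ F_{μν}`, holds pointwise (Waldron 2019 (YM);
  Struwe 1994 (3)–(4); Charalambous–Gross 2013 (1.2); Donaldson–Kronheimer §6.2.3). Only `t > 0`
  is constrained (immortal flow lines on `(0,∞)`; values at `t ≤ 0` are junk). Stationary flow
  lines are exactly the Yang–Mills connections (`isYangMillsHeatFlow_const_iff`).
* `FlowLine E 𝔤 m`: immortal flow lines with the **`C^m_loc` topology** — uniform convergence of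
  the spatial jets `(t, x) ↦ D_x^k (A t)(x)`, `k ≤ m`, on compact subsets of `(0,∞) × E`
  (`FlowLine.tendsto_iff`); `FlowLine.gaugeSetoid U`: `A ∼ B` iff `B t = g • A t` for all `t > 0`
  for one *time-independent* `g ∈ smoothGaugeGroup E U` (the symmetry group of the flow);
  `FlowLineSpace E 𝔤 U m`: the quotient (gauge orbits of immortal flow lines) with the quotient
  topology and its Borel σ-algebra — laws of random flow lines mod gauge are `Measure`s on it.
* `Connection.IsLatticePeriodic` (the flat torus `ℝ⁴/Lℤ⁴` as `L`-periodic data on `ℝ⁴`) and the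
  named fact `Waldron2019_yangMillsFlow_flatTorus` (global smooth solutions from smooth periodic
  `𝔲(N)`-valued data: Waldron 2019 Cor. 1.2 with Struwe's short-time existence).

Design: `𝔤 : Submodule ℝ 𝔸` as in `Connection.IsValuedIn` (`𝔲(N) = skewAdjoint.submodule`,
`𝔰𝔲(N) = suAlgebra N`; a Lie subalgebra in practice, not needed by the predicate); `m : ℕ∞` is a
phantom parameter of `FlowLine` selecting the topology (like `𝔖` in Mathlib's `UniformOnFun`).
Not here: local existence/uniqueness/regularity, energy monotonicity, invariance of
`IsYangMillsHeatFlow` under `gaugeAct` (needs the named fact `curvature_gaugeAct`), Polishness.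

References: A. Waldron, *Long-time existence for Yang–Mills flow*, Invent. Math. 217 (2019),
§1 (YM), Thm. 1.1, Cor. 1.2 [Waldron2019]; M. Struwe, *The Yang–Mills flow in four dimensions*,
Calc. Var. 2 (1994), (3)–(4) [Struwe1994]; N. Charalambous, L. Gross, CMP 317 (2013), (1.2)
[CharalambousGross2012]; S. K. Donaldson, P. B. Kronheimer, *The Geometry of Four-Manifolds*
(1990), §2.1, §6.2.3, §6.3.1 [DonaldsonKronheimer1990].
-/

noncomputable section

open scoped ContDiff UniformConvergence Topology Uniformity
open MeasureTheory Filter Set Module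

namespace Literature.MathematicalPhysics.QuantumLattice

section GaugeAction

variable {E : Type*} [NormedAddCommGroup E] [InnerProductSpace ℝ E]
variable {𝔸 : Type*} [NormedRing 𝔸] [NormedAlgebra ℝ 𝔸]

/-! ### Smooth gauge transformations act on connections -/

/-- The gauge action of the constant transformation `1` is trivial: `1 • A = A`.
Donaldson–Kronheimer (2.1.7). [folklore] -/
@[simp]
theorem gaugeAct_one (A : Connection E 𝔸) : gaugeAct (1 : E → 𝔸ˣ) A = A := by
  funext x; ext v
  simp [gaugeAct_apply]

/-- The gauge action is a left action of differentiable gauge transformations: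
`(g h) • A = g • (h • A)` (product rule for `d(gh)`). Donaldson–Kronheimer (2.1.7). [folklore] -/
theorem gaugeAct_mul (g h : E → 𝔸ˣ) (hg : Differentiable ℝ fun x => (g x : 𝔸))
    (hh : Differentiable ℝ fun x => (h x : 𝔸)) (A : Connection E 𝔸) :
    gaugeAct (g * h) A = gaugeAct g (gaugeAct h A) := by
  funext x; ext v
  have hprod : fderiv ℝ (fun y => (g y : 𝔸) * (h y : 𝔸)) x v =
      (g x : 𝔸) * fderiv ℝ (fun y => (h y : 𝔸)) x v +
        fderiv ℝ (fun y => (g y : 𝔸)) x v * (h x : 𝔸) := by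
    rw [fderiv_fun_mul' (hg x) (hh x)]
    simp
  have h1 : (h x : 𝔸) * ((h x)⁻¹ : 𝔸ˣ) = 1 := Units.mul_inv _
  have key : fderiv ℝ (fun y => (g y : 𝔸)) x v * (h x : 𝔸) *
      (((h x)⁻¹ : 𝔸ˣ) * ((g x)⁻¹ : 𝔸ˣ) : 𝔸) =
      fderiv ℝ (fun y => (g y : 𝔸)) x v * ((g x)⁻¹ : 𝔸ˣ) := by
    rw [← mul_assoc, mul_assoc _ (h x : 𝔸), h1, mul_one]
  simp only [gaugeAct_apply, Pi.mul_apply, mul_inv_rev, Units.val_mul, hprod]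
  rw [add_mul, key]
  noncomm_ring

section Inverse

variable [HasSummableGeomSeries 𝔸]

/-- Pointwise inversion preserves differentiability of unit-valued maps. [folklore] -/
theorem differentiable_units_inv {g : E → 𝔸ˣ} (hg : Differentiable ℝ fun x => (g x : 𝔸)) :
    Differentiable ℝ fun x => ((g⁻¹ x : 𝔸ˣ) : 𝔸) := by
  simpa only [Pi.inv_apply, Ring.inverse_unit] using hg.inverse fun x => (g x).isUnit

/-- Pointwise inversion preserves smoothness of unit-valued maps. [folklore] -/
theorem contDiff_units_inv {n : WithTop ℕ∞} {g : E → 𝔸ˣ}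
    (hg : ContDiff ℝ n fun x => (g x : 𝔸)) : ContDiff ℝ n fun x => ((g⁻¹ x : 𝔸ˣ) : 𝔸) := by
  have e : (fun x => ((g⁻¹ x : 𝔸ˣ) : 𝔸)) = Ring.inverse ∘ fun x => (g x : 𝔸) :=
    funext fun x => by simp
  rw [e]
  exact contDiff_iff_contDiffAt.2 fun x => (contDiffAt_ringInverse ℝ (g x)).comp x hg.contDiffAt

/-- `g⁻¹ • (g • A) = A` for differentiable gauge transformations.
Donaldson–Kronheimer (2.1.7). [folklore] -/
theorem gaugeAct_inv_gaugeAct (g : E → 𝔸ˣ) (hg : Differentiable ℝ fun x => (g x : 𝔸))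
    (A : Connection E 𝔸) : gaugeAct g⁻¹ (gaugeAct g A) = A := by
  rw [← gaugeAct_mul g⁻¹ g (differentiable_units_inv hg) hg, inv_mul_cancel, gaugeAct_one]

/-- `g • (g⁻¹ • A) = A` for differentiable gauge transformations.
Donaldson–Kronheimer (2.1.7). [folklore] -/
theorem gaugeAct_gaugeAct_inv (g : E → 𝔸ˣ) (hg : Differentiable ℝ fun x => (g x : 𝔸))
    (A : Connection E 𝔸) : gaugeAct g (gaugeAct g⁻¹ A) = A := by
  rw [← gaugeAct_mul g g⁻¹ hg (differentiable_units_inv hg), mul_inv_cancel, gaugeAct_one]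

variable (E) in
/-- The group `𝒢_U` of smooth gauge transformations `g : E → 𝔸ˣ` with values in the subgroup
`U ≤ 𝔸ˣ` (e.g. `U = unitaryUnits 𝔸`, the unitary group `U(N)` for `𝔸 = M_N(ℂ)`).
Donaldson–Kronheimer §2.1.1 (the gauge group). [folklore] -/
def smoothGaugeGroup (U : Subgroup 𝔸ˣ) : Subgroup (E → 𝔸ˣ) where
  carrier := {g | ContDiff ℝ ∞ (fun x => (g x : 𝔸)) ∧ ∀ x, g x ∈ U}
  mul_mem' {g h} hg hh :=
    ⟨by simpa only [Pi.mul_apply, Units.val_mul] using hg.1.mul hh.1,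
      fun x => U.mul_mem (hg.2 x) (hh.2 x)⟩
  one_mem' := ⟨by simpa using contDiff_const (c := (1 : 𝔸)), fun _ => U.one_mem⟩
  inv_mem' {g} hg := ⟨contDiff_units_inv hg.1, fun x => U.inv_mem (hg.2 x)⟩

/-- Membership in the smooth gauge group. [folklore] -/
theorem mem_smoothGaugeGroup_iff {U : Subgroup 𝔸ˣ} {g : E → 𝔸ˣ} :
    g ∈ smoothGaugeGroup E U ↔ ContDiff ℝ ∞ (fun x => (g x : 𝔸)) ∧ ∀ x, g x ∈ U :=
  Iff.rfl

end Inverse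

variable (𝔸) in
/-- The unitary group `U(𝔸) = {u | u⋆ u = u u⋆ = 1}` as a subgroup of the units (Mathlib
`Unitary.toUnits`); for `𝔸 = M_N(ℂ)` this is `U(N)`, the gauge group of lattice and continuum
Yang–Mills theory with compact structure group. [folklore] -/
def unitaryUnits [StarMul 𝔸] : Subgroup 𝔸ˣ :=
  (Unitary.toUnits : unitary 𝔸 →* 𝔸ˣ).range

end GaugeAction

section Flow

variable {E : Type*} [NormedAddCommGroup E] [InnerProductSpace ℝ E] [FiniteDimensional ℝ E]
variable {𝔸 : Type*} [NormedRing 𝔸] [NormedAlgebra ℝ 𝔸]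

/-! ### The flow equation -/

/-- The covariant divergence of the curvature, `(div_A F_A)(x)(v) = ∑ᵢ D_{eᵢ} (F_A(eᵢ, v))(x)` in
the standard orthonormal frame `e = stdOrthonormalBasis ℝ E`; this is `−(D_A^* F_A)(x)(v)`, minus
the `L²`-gradient of the Yang–Mills functional. Meaningful for smooth `A` (junk `fderiv = 0`
otherwise). Waldron (2019) §1 (YM); Donaldson–Kronheimer (6.2.8). [cite: Waldron2019, §1 (YM)] -/
def divCurvature (A : Connection E 𝔸) (x v : E) : 𝔸 :=
  ∑ i, covDeriv A (fun y => curvature A y (stdOrthonormalBasis ℝ E i) v) x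
    (stdOrthonormalBasis ℝ E i)

/-- The Yang–Mills equation `D_A^* F_A = 0` says exactly that the covariant divergence of the
curvature vanishes. [folklore] -/
theorem isYangMillsConnection_iff_divCurvature_eq_zero (A : Connection E 𝔸) :
    IsYangMillsConnection A ↔ ∀ x v : E, divCurvature A x v = 0 :=
  Iff.rfl

/-- **The Yang–Mills heat flow** (Yang–Mills gradient flow) for a time-dependent connection
`A : ℝ → Connection E 𝔸` on flat space, as an immortal flow line on `(0, ∞)`: for every `t > 0`,
`x ↦ A t x` is smooth and `𝔤`-valued, `t ↦ A t x v` is `C¹` on `(0,∞)`, and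
`∂ₜ A_v(t, x) = ∑_μ D_μ F_{μ v}(t, x) = −(D_A^* F_A)_v`, the gradient flow of `YM(A) = ½ ∫ |F_A|²`.
Values of `A` at `t ≤ 0` are not constrained (junk). Waldron (2019) eq. (YM) `∂A/∂t = −D_A^* F_A`;
Struwe (1994) eqs. (3)–(4); Charalambous–Gross (2013) eq. (1.2).
[cite: Waldron2019, §1 eq. (YM)] -/
structure IsYangMillsHeatFlow (𝔤 : Submodule ℝ 𝔸) (A : ℝ → Connection E 𝔸) : Prop where
  /-- spatial smoothness at every positive time -/
  smooth : ∀ ⦃t : ℝ⦄, 0 < t → IsSmoothConnection (A t)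
  /-- the connection is `𝔤`-valued at every positive time -/
  isValuedIn : ∀ ⦃t : ℝ⦄, 0 < t → (A t).IsValuedIn 𝔤
  /-- the flow equation `∂ₜ A = div_A F_A = −D_A^* F_A`, pointwise, classical time derivative -/
  hasDerivAt : ∀ ⦃t : ℝ⦄, 0 < t → ∀ x v : E,
    HasDerivAt (fun s => A s x v) (divCurvature (A t) x v) t
  /-- `C¹` in time: the time derivative is continuous on `(0, ∞)` -/
  continuousOn_deriv : ∀ x v : E, ContinuousOn (fun t => divCurvature (A t) x v) (Ioi 0)

/-- A time-independent smooth `𝔤`-valued connection is a (stationary) flow line iff it is a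
Yang–Mills connection: critical points of `YM` are the fixed points of its gradient flow.
Donaldson–Kronheimer §6.2.3. [folklore] -/
theorem isYangMillsHeatFlow_const_iff {𝔤 : Submodule ℝ 𝔸} {A : Connection E 𝔸}
    (hs : IsSmoothConnection A) (hv : A.IsValuedIn 𝔤) :
    IsYangMillsHeatFlow 𝔤 (fun _ : ℝ => A) ↔ IsYangMillsConnection A := by
  constructor
  · intro h x v
    exact (h.hasDerivAt one_pos x v).unique (hasDerivAt_const (1 : ℝ) (A x v))
  · intro hYM
    refine ⟨fun _ _ => hs, fun _ _ => hv, fun t _ x v => ?_, fun x v => continuousOn_const⟩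
    rw [(isYangMillsConnection_iff_divCurvature_eq_zero A).1 hYM x v]
    exact hasDerivAt_const t (A x v)

/-- The product (zero) connection is a stationary flow line, for any `𝔤`. [folklore] -/
theorem isYangMillsHeatFlow_zero (𝔤 : Submodule ℝ 𝔸) :
    IsYangMillsHeatFlow 𝔤 (fun _ : ℝ => (0 : Connection E 𝔸)) :=
  (isYangMillsHeatFlow_const_iff contDiff_const fun _ _ => 𝔤.zero_mem).2
    isFlat_zero.isYangMillsConnection

/-- Time translation: if `A` is a flow line then so is `t ↦ A (t + τ)` for `τ ≥ 0` (the flow is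
autonomous). [folklore] -/
theorem IsYangMillsHeatFlow.comp_add {𝔤 : Submodule ℝ 𝔸} {A : ℝ → Connection E 𝔸}
    (h : IsYangMillsHeatFlow 𝔤 A) {τ : ℝ} (hτ : 0 ≤ τ) :
    IsYangMillsHeatFlow 𝔤 (fun t => A (t + τ)) where
  smooth t ht := h.smooth (by positivity)
  isValuedIn t ht := h.isValuedIn (by positivity)
  hasDerivAt t ht x v := HasDerivAt.comp_add_const t τ (h.hasDerivAt (by positivity) x v)
  continuousOn_deriv x v :=
    (h.continuousOn_deriv x v).comp (continuousOn_id.add continuousOn_const)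
      fun t (ht : 0 < t) => show 0 < t + τ by positivity

/-! ### Flow lines, the `C^m_loc` topology, and the quotient by gauge -/

variable (E) in
/-- An immortal **flow line** of the Yang–Mills heat flow with values in `𝔤`: a time-dependent
connection solving the flow on `(0, ∞)` (`IsYangMillsHeatFlow`). The parameter `m : ℕ∞` does not
constrain the data; it selects the topology (`C^m_loc` convergence, `FlowLine.instUniformSpace`).
Waldron (2019) §1; Struwe (1994) (3)–(4). [cite: Waldron2019, §1 eq. (YM)] -/
structure FlowLine (𝔤 : Submodule ℝ 𝔸) (m : ℕ∞) where
  /-- the underlying time-dependent connection (values at `t ≤ 0` are irrelevant) -/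
  conn : ℝ → Connection E 𝔸
  /-- it solves the Yang–Mills heat flow on `(0, ∞)` -/
  isFlow : IsYangMillsHeatFlow 𝔤 conn

variable {𝔤 : Submodule ℝ 𝔸} {m : ℕ∞}

/-- The stationary flow line of a smooth `𝔤`-valued Yang–Mills connection. [folklore] -/
def FlowLine.const (A : Connection E 𝔸) (hs : IsSmoothConnection A) (hv : A.IsValuedIn 𝔤)
    (hYM : IsYangMillsConnection A) : FlowLine E 𝔤 m :=
  ⟨fun _ => A, (isYangMillsHeatFlow_const_iff hs hv).2 hYM⟩

/-- The zero connection as a flow line (non-vacuity). [folklore] -/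
instance FlowLine.instInhabited : Inhabited (FlowLine E 𝔤 m) :=
  ⟨⟨fun _ => 0, isYangMillsHeatFlow_zero 𝔤⟩⟩

variable (E) in
/-- The directed family of sets on which convergence is uniform: compact subsets of positive
space-time `(0, ∞) × E` ("compact time intervals, compact in space"). [folklore] -/
def flowCompacts : Set (Set (ℝ × E)) :=
  {K | IsCompact K ∧ K ⊆ Ioi (0 : ℝ) ×ˢ univ}

/-- The `k`-th spatial jet of a time-dependent connection as a function on space-time,
`(t, x) ↦ D_x^k (A t)(x)`. [folklore] -/
def spatialJet (k : ℕ) (A : ℝ → Connection E 𝔸) :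
    ℝ × E → E [×k]→L[ℝ] (E →L[ℝ] 𝔸) :=
  fun p => iteratedFDeriv ℝ k (A p.1) p.2

/-- The jet maps `A ↦ ((t, x) ↦ D_x^k (A t)(x))`, valued in the functions on space-time with the
uniform structure of uniform convergence on the sets of `flowCompacts E` (`UniformOnFun`).
[folklore] -/
def FlowLine.jet (k : ℕ) (A : FlowLine E 𝔤 m) :
    (ℝ × E) →ᵤ[flowCompacts E] (E [×k]→L[ℝ] (E →L[ℝ] 𝔸)) :=
  UniformOnFun.ofFun (flowCompacts E) (spatialJet k A.conn)

/-- The **`C^m_loc` uniform structure** on flow lines: the coarsest making every jet map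
`FlowLine.jet k`, `k ≤ m`, uniformly continuous (uniform convergence of spatial derivatives of
order `≤ m` on compacts of `(0,∞) × E`); its topology: `FlowLine.tendsto_iff`. [folklore] -/
instance FlowLine.instUniformSpace : UniformSpace (FlowLine E 𝔤 m) :=
  ⨅ (k : ℕ) (_ : (k : ℕ∞) ≤ m), UniformSpace.comap (FlowLine.jet k) inferInstance

/-- The uniformity of `FlowLine E 𝔤 m`: infimum of the pull-backs along the jets. [folklore] -/
theorem FlowLine.uniformity_eq :
    𝓤 (FlowLine E 𝔤 m) = ⨅ (k : ℕ) (_ : (k : ℕ∞) ≤ m),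
      Filter.comap (Prod.map (FlowLine.jet k) (FlowLine.jet k))
        (𝓤 ((ℝ × E) →ᵤ[flowCompacts E] (E [×k]→L[ℝ] (E →L[ℝ] 𝔸)))) := by
  change 𝓤[⨅ (k : ℕ) (_ : (k : ℕ∞) ≤ m),
    UniformSpace.comap (FlowLine.jet (E := E) (𝔤 := 𝔤) (m := m) k) inferInstance] = _
  rw [iInf_uniformity]
  refine iInf_congr fun k => ?_
  rw [iInf_uniformity]
  rfl

/-- **`C^m_loc` convergence.** A net of flow lines converges iff, for every `k ≤ m`, the `k`-th
spatial jets converge uniformly on every compact subset of `(0, ∞) × E`. [folklore] -/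
theorem FlowLine.tendsto_iff {ι : Type*} {l : Filter ι} (F : ι → FlowLine E 𝔤 m)
    (A : FlowLine E 𝔤 m) :
    Tendsto F l (𝓝 A) ↔ ∀ k : ℕ, (k : ℕ∞) ≤ m → ∀ K ∈ flowCompacts E,
      TendstoUniformlyOn (fun i => spatialJet k (F i).conn) (spatialJet k A.conn) l K := by
  rw [Uniform.tendsto_nhds_right, FlowLine.uniformity_eq]
  simp only [tendsto_iInf, tendsto_comap_iff]
  refine forall₂_congr fun k _ => ?_
  rw [show Prod.map (FlowLine.jet k) (FlowLine.jet k) ∘ (fun i => (A, F i)) =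
      fun i => (FlowLine.jet k A, FlowLine.jet k (F i)) from rfl, ← Uniform.tendsto_nhds_right,
    UniformOnFun.tendsto_iff_tendstoUniformlyOn]
  rfl

variable [HasSummableGeomSeries 𝔸]

/-- **Gauge equivalence of flow lines**: `A ∼ B` iff `B t = g • A t` for all `t > 0` for a single
time-independent smooth gauge transformation `g ∈ smoothGaugeGroup E U` (the flow equation is
invariant under these). An equivalence relation by `gaugeAct_one/mul/inv_gaugeAct`.
Donaldson–Kronheimer §2.1.1, §6.2.3. [folklore] -/
def FlowLine.gaugeSetoid (U : Subgroup 𝔸ˣ) : Setoid (FlowLine E 𝔤 m) where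
  r A B := ∃ g ∈ smoothGaugeGroup E U, ∀ t : ℝ, 0 < t → B.conn t = gaugeAct g (A.conn t)
  iseqv :=
    { refl := fun A => ⟨1, Subgroup.one_mem _, fun t _ => (gaugeAct_one _).symm⟩
      symm := fun {A B} ⟨g, hg, hAB⟩ => ⟨g⁻¹, Subgroup.inv_mem _ hg, fun t ht => by
        rw [hAB t ht, gaugeAct_inv_gaugeAct g (hg.1.differentiable (by simp))]⟩
      trans := fun {A B C} ⟨g, hg, hAB⟩ ⟨h, hh, hBC⟩ => ⟨h * g, Subgroup.mul_mem _ hh hg,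
        fun t ht => by
          rw [hBC t ht, hAB t ht, gaugeAct_mul h g (hh.1.differentiable (by simp))
            (hg.1.differentiable (by simp))]⟩ }

variable (E) in
/-- **The flow-line state space**: gauge orbits (under the time-independent smooth gauge group
`smoothGaugeGroup E U`) of immortal Yang–Mills flow lines, `FlowLine E 𝔤 m ⧸ ∼`, with the quotient
of the `C^m_loc` topology ("`C^m_loc` convergence mod gauge on compact time intervals").
[folklore] -/
def FlowLineSpace (𝔤 : Submodule ℝ 𝔸) (U : Subgroup 𝔸ˣ) (m : ℕ∞) : Type _ :=
  Quotient (FlowLine.gaugeSetoid (E := E) (𝔤 := 𝔤) (m := m) U)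

variable {U : Subgroup 𝔸ˣ}

/-- The quotient topology on the flow-line state space. [folklore] -/
instance FlowLineSpace.instTopologicalSpace : TopologicalSpace (FlowLineSpace E 𝔤 U m) :=
  inferInstanceAs (TopologicalSpace (Quotient (FlowLine.gaugeSetoid U)))

/-- The Borel σ-algebra of the flow-line state space. [folklore] -/
instance FlowLineSpace.instMeasurableSpace : MeasurableSpace (FlowLineSpace E 𝔤 U m) :=
  borel _

/-- The σ-algebra on the flow-line state space is the Borel one, by definition. [folklore] -/
instance FlowLineSpace.instBorelSpace : BorelSpace (FlowLineSpace E 𝔤 U m) :=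
  ⟨rfl⟩

/-- The gauge orbit of a flow line. [folklore] -/
def FlowLineSpace.mk (A : FlowLine E 𝔤 m) : FlowLineSpace E 𝔤 U m :=
  Quotient.mk _ A

/-- The flow-line state space is non-empty (orbit of the zero flow line). [folklore] -/
instance FlowLineSpace.instInhabited : Inhabited (FlowLineSpace E 𝔤 U m) :=
  ⟨FlowLineSpace.mk default⟩

/-- Two flow lines have the same orbit iff one smooth time-independent `U`-valued gauge
transformation relates them on `(0, ∞)`. [folklore] -/
theorem FlowLineSpace.mk_eq_mk_iff {A B : FlowLine E 𝔤 m} :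
    (FlowLineSpace.mk A : FlowLineSpace E 𝔤 U m) = FlowLineSpace.mk B ↔
      ∃ g ∈ smoothGaugeGroup E U, ∀ t : ℝ, 0 < t → B.conn t = gaugeAct g (A.conn t) :=
  Quotient.eq

/-- The orbit map is continuous (quotient topology). [folklore] -/
theorem FlowLineSpace.continuous_mk :
    Continuous (FlowLineSpace.mk : FlowLine E 𝔤 m → FlowLineSpace E 𝔤 U m) :=
  continuous_quotient_mk'

/-- The orbit map is a topological quotient map. [folklore] -/
theorem FlowLineSpace.isQuotientMap_mk :
    Topology.IsQuotientMap (FlowLineSpace.mk : FlowLine E 𝔤 m → FlowLineSpace E 𝔤 U m) :=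
  isQuotientMap_quotient_mk'

end Flow

/-! ### The flat 4-torus and global existence (Waldron 2019) -/

section Torus

open scoped Matrix.Norms.Frobenius

variable {𝔸 : Type*} [NormedRing 𝔸] [NormedAlgebra ℝ 𝔸]

/-- A connection on `ℝ^ι` is `L`-periodic (descends to the trivial bundle over the flat torus
`ℝ^ι / Lℤ^ι`) if `A (x + L eᵢ) = A x` for every coordinate vector `eᵢ`. [folklore] -/
def Connection.IsLatticePeriodic {ι : Type*} [Fintype ι] [DecidableEq ι] (L : ℝ)
    (A : Connection (EuclideanSpace ℝ ι) 𝔸) : Prop :=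
  ∀ (x : EuclideanSpace ℝ ι) (i : ι), A (x + EuclideanSpace.single i L) = A x

/-- **Global existence of the Yang–Mills flow on the flat 4-torus** (Waldron 2019). Over a compact
Riemannian 4-manifold any classical solution of (YM) extends smoothly for all time (Cor. 1.2, from
Thm. 1.1: no finite-time energy concentration), and smooth initial data launch a classical
solution (Struwe's short-time existence, as invoked there). Vendored for the trivial `U(N)`-bundle
over `ℝ⁴/Lℤ⁴`, i.e. `L`-periodic `𝔲(N)`-valued connections on `ℝ⁴` (`𝔲(N) =
skewAdjoint.submodule ℝ M_N(ℂ)`): every smooth periodic `𝔲(N)`-valued `A₀` is the initial value of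
a solution `A`, smooth on `[0, ∞) × ℝ⁴`, periodic, solving the Yang–Mills heat flow for all `t > 0`.
[cite: Waldron2019, Cor. 1.2] -/
def Waldron2019_yangMillsFlow_flatTorus : Prop :=
  ∀ (N : ℕ) (L : ℝ), 0 < L →
    ∀ A₀ : Connection (EuclideanSpace ℝ (Fin 4)) (Matrix (Fin N) (Fin N) ℂ),
      IsSmoothConnection A₀ →
      A₀.IsValuedIn (skewAdjoint.submodule ℝ (Matrix (Fin N) (Fin N) ℂ)) →
      A₀.IsLatticePeriodic L →
      ∃ A : ℝ → Connection (EuclideanSpace ℝ (Fin 4)) (Matrix (Fin N) (Fin N) ℂ),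
        A 0 = A₀ ∧
        ContDiffOn ℝ ∞ (fun p : ℝ × EuclideanSpace ℝ (Fin 4) => A p.1 p.2) (Ici 0 ×ˢ univ) ∧
        (∀ t : ℝ, 0 ≤ t → (A t).IsLatticePeriodic L) ∧
        IsYangMillsHeatFlow (skewAdjoint.submodule ℝ (Matrix (Fin N) (Fin N) ℂ)) A

end Torus

end Literature.MathematicalPhysics.QuantumLattice
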